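import Summits.ValiantsHypothesis.ValiantsHypothesis.Theorems.KPlusLogSqLawTropicalSymmetricOrbitThreeFourSeventeen

/-!
# Route «KPlusLogSqLaw» — `TSymOrb34Le16`: orientation normalisation of the pair carriers of an abstract orbit chain (`orient_elim`)

HONEST FRAMING.  Helper file (seat val-sym-lift-p2 (g7), cell `pub-symmetroid`, 2026-08-27; `--supports` the `WeakLifting` item
stmt-ValiantsHypothesis-19561 as a helper, no closure claim).  Bookkeeping for the generated case analysis `core16` («T^orb_sym(3,4) ≤ 16»,
docket R1797/R1798): the abstract chain hypotheses (shapes, M, S, R1w–R3′w, T-triple, P1, P2) are invariant under replacing a pair-carrier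
term by its TRANSPOSE (same unordered cells, same letters), so WLOG every fixed-point-free carrier of the chain is `finRotate 3`
(`orient_elim`, an eliminator in the style of `mirror_elim`).  The generated case files assume this normalisation (`hnorm`).  No census
numeral; `TSymOrb34Le16` NOT asserted here; nothing on `TropicalB` / `WeakLifting` in their windows, DoorA34 / DoorA26 (OPEN),
`MatrixDescartes` (stmt-ValiantsHypothesis-18050) or VP ≠ VNP.  [bookkeeping; seat val-sym-lift-p2 g7]
-/

set_option linter.dupNamespace false
set_option linter.unusedVariables false
set_option linter.unusedSectionVars false
set_option autoImplicit false

namespace Summit.ValiantsHypothesis.ValiantsHypothesis.Theorems.KPlusLogSqLaw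

open Summit.ValiantsHypothesis.ValiantsHypothesis.Theorems.MatrixDescartes.Negative
open Summit.ValiantsHypothesis.ValiantsHypothesis.Theorems.LacunarySymmetroidMatrixDescartes
open Summit.ValiantsHypothesis.ValiantsHypothesis.Theorems.LacunarySymmetroidMatrixDescartes.TropicalCensus
open Summit.ValiantsHypothesis.ValiantsHypothesis.Theorems.LacunarySymmetroidMatrixDescartes.TropicalCensus.Orbit
open Finset

namespace SymmetricOrbitThreeFourSixteen

/-! ## Small facts about `finRotate 3` and column relabelling -/

/-- the two fixed-point-free permutations of `Fin 3`. -/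
theorem fpf_cases : ∀ σ : Equiv.Perm (Fin 3), (∀ i, σ i ≠ i) → σ = finRotate 3 ∨ σ = (finRotate 3)⁻¹ := by decide

/-- `finRotate 3` is fixed-point-free and differs from its inverse, from `1` and from every transposition. -/
theorem rho_facts : (∀ i : Fin 3, (finRotate 3) i ≠ i) ∧ (finRotate 3 : Equiv.Perm (Fin 3)) ≠ (finRotate 3)⁻¹ ∧
    ((finRotate 3)⁻¹)⁻¹ = (finRotate 3 : Equiv.Perm (Fin 3)) ∧ (finRotate 3 : Equiv.Perm (Fin 3)) ≠ 1 ∧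
    (∀ i j : Fin 3, (finRotate 3 : Equiv.Perm (Fin 3)) ≠ Equiv.swap i j) := by
  refine ⟨by decide, by decide, by simp, by decide, by decide⟩

/-- the class multiset is unchanged by relabelling the columns with a permutation. -/
theorem classSym_comp_perm (σ σ' π : Equiv.Perm (Fin 3)) (lam : Fin 3 → Fin 4) :
    TropicalCensus.classSym ((σ', fun i => lam (π i)) : Equiv.Perm (Fin 3) × (Fin 3 → Fin 4)) =
      TropicalCensus.classSym ((σ, lam) : Equiv.Perm (Fin 3) × (Fin 3 → Fin 4)) := by
  unfold TropicalCensus.classSym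
  apply Subtype.ext
  show (univ : Finset (Fin 3)).val.map (fun i => lam (π i)) = (univ : Finset (Fin 3)).val.map lam
  have hc : (fun i => lam (π i)) = lam ∘ ⇑π := rfl
  rw [hc, ← Multiset.map_map]
  congr 1
  have h := congrArg Finset.val (Finset.map_univ_equiv π)
  rw [Finset.map_val, Equiv.coe_toEmbedding] at h
  exact h

/-- the exponent sum is unchanged by relabelling the columns with a permutation. -/
theorem slope_comp_perm (g : Fin 4 → ℕ) (σ σ' π : Equiv.Perm (Fin 3)) (lam : Fin 3 → Fin 4) :
    TropicalCensus.slope g ((σ', fun i => lam (π i)) : Equiv.Perm (Fin 3) × (Fin 3 → Fin 4)) =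
      TropicalCensus.slope g ((σ, lam) : Equiv.Perm (Fin 3) × (Fin 3 → Fin 4)) := by
  rw [slope_eq_of_classSym, slope_eq_of_classSym, classSym_comp_perm]

/-! ## The eliminator -/

/-- **`orient_elim`** (WLOG every pair carrier is `finRotate 3`).  Replacing each chain element whose carrier is `(finRotate 3)⁻¹` by its
transpose `(finRotate 3, λ ∘ finRotate 3)` preserves every hypothesis of the abstract 16-interface and the class multisets; so anything
contradictory for all normalised chains is contradictory. [bookkeeping: transposed cells are the same unordered cells] -/
theorem orient_elim (r : Fin 18 → Equiv.Perm (Fin 3) × (Fin 3 → Fin 4)) (g : Fin 4 → ℕ)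
    (hshape : ∀ k, (r k).1 = 1 ∨ (∃ i j : Fin 3, i < j ∧ (r k).1 = Equiv.swap i j ∧ (r k).2 i = (r k).2 j) ∨ (∀ i, (r k).1 i ≠ i))
    (hM : ∀ a b : Fin 18, a < b → ∀ l₁ l₂ : Fin 3,
      ((r a).1 l₁ = (r b).1 l₂ ∧ l₁ = l₂) ∨ ((r a).1 l₁ = l₂ ∧ (r b).1 l₂ = l₁) → (r a).2 l₁ ≤ (r b).2 l₂)
    (hS : ∀ a b : Fin 18, a < b → TropicalCensus.slope g (r a) < TropicalCensus.slope g (r b))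
    (hR1 : ∀ a b : Fin 18, a < b → (r a).1 = 1 → ∀ i j : Fin 3, i ≠ j → (r b).1 = Equiv.swap i j → (r b).2 i = (r b).2 j →
      g ((r a).2 i) + g ((r a).2 j) < 2 * g ((r b).2 i))
    (hR1' : ∀ a b : Fin 18, a < b → (r b).1 = 1 → ∀ i j : Fin 3, i ≠ j → (r a).1 = Equiv.swap i j → (r a).2 i = (r a).2 j →
      2 * g ((r a).2 i) < g ((r b).2 i) + g ((r b).2 j))
    (hR2 : ∀ a b : Fin 18, a < b → ∀ i j k : Fin 3, i ≠ j → k ≠ i → k ≠ j → (r a).1 = Equiv.swap i j →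
      (r a).2 i = (r a).2 j → (r b).1 i = j → (r b).1 j = k → (r b).1 k = i →
      g ((r a).2 k) + g ((r a).2 i) < g ((r b).2 j) + g ((r b).2 k))
    (hR2' : ∀ a b : Fin 18, a < b → ∀ i j k : Fin 3, i ≠ j → k ≠ i → k ≠ j → (r a).1 i = j → (r a).1 j = k → (r a).1 k = i →
      (r b).1 = Equiv.swap i j → (r b).2 i = (r b).2 j → g ((r a).2 j) + g ((r a).2 k) < g ((r b).2 k) + g ((r b).2 i))
    (hR3 : ∀ a b : Fin 18, a < b → (r a).1 = 1 → ∀ i j k : Fin 3, i ≠ j → k ≠ i → k ≠ j →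
      (r b).1 i = j → (r b).1 j = k → (r b).1 k = i → g ((r a).2 i) + g ((r a).2 j) < 2 * g ((r b).2 i))
    (hR3' : ∀ a b : Fin 18, a < b → (r b).1 = 1 → ∀ i j k : Fin 3, i ≠ j → k ≠ i → k ≠ j →
      (r a).1 i = j → (r a).1 j = k → (r a).1 k = i → 2 * g ((r a).2 i) < g ((r b).2 i) + g ((r b).2 j))
    (hT3 : ∀ a b c : Fin 18, ∀ i j k : Fin 3, i ≠ j → k ≠ i → k ≠ j →
      (r a).1 = Equiv.swap j k → (r a).2 j = (r a).2 k → (r b).1 = Equiv.swap i k → (r b).2 i = (r b).2 k →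
      (r c).1 = Equiv.swap i j → (r c).2 i = (r c).2 j →
      ¬ (g ((r c).2 i) + g ((r a).2 j) + g ((r b).2 k) ≤ g ((r a).2 i) + 2 * g ((r a).2 j) ∧
          g ((r c).2 i) + g ((r a).2 j) + g ((r b).2 k) ≤ g ((r b).2 j) + 2 * g ((r b).2 k) ∧
          g ((r c).2 i) + g ((r a).2 j) + g ((r b).2 k) ≤ g ((r c).2 k) + 2 * g ((r c).2 i) ∧
          g ((r a).2 i) + 2 * g ((r a).2 j) ≤ g ((r a).2 i) + g ((r b).2 j) + g ((r c).2 k) ∧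
          g ((r b).2 j) + 2 * g ((r b).2 k) ≤ g ((r a).2 i) + g ((r b).2 j) + g ((r c).2 k) ∧
          g ((r c).2 k) + 2 * g ((r c).2 i) ≤ g ((r a).2 i) + g ((r b).2 j) + g ((r c).2 k)) ∧
      ¬ (g ((r a).2 i) + g ((r b).2 j) + g ((r c).2 k) ≤ g ((r a).2 i) + 2 * g ((r a).2 j) ∧
          g ((r a).2 i) + g ((r b).2 j) + g ((r c).2 k) ≤ g ((r b).2 j) + 2 * g ((r b).2 k) ∧
          g ((r a).2 i) + g ((r b).2 j) + g ((r c).2 k) ≤ g ((r c).2 k) + 2 * g ((r c).2 i) ∧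
          g ((r a).2 i) + 2 * g ((r a).2 j) ≤ g ((r c).2 i) + g ((r a).2 j) + g ((r b).2 k) ∧
          g ((r b).2 j) + 2 * g ((r b).2 k) ≤ g ((r c).2 i) + g ((r a).2 j) + g ((r b).2 k) ∧
          g ((r c).2 k) + 2 * g ((r c).2 i) ≤ g ((r c).2 i) + g ((r a).2 j) + g ((r b).2 k)))
    (hP1 : ∀ a b : Fin 18, ∀ k : Fin 3, (r a).1 ≠ 1 → (r a).1 k = k → (r b).1 ≠ 1 → (r b).1 k = k →
      (r a).2 k = (r b).2 k → (a.val + b.val) % 2 = 0)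
    (hP2 : ∀ e a0 a1 a2 : Fin 18, ∀ κ0 κ1 κ2 : Fin 3, κ0 ≠ κ1 → κ0 ≠ κ2 → κ1 ≠ κ2 → (r e).1 = 1 →
      ((r a0).1 ≠ 1 ∧ (r a0).1 κ0 = κ0 ∧ (r a0).2 κ0 = (r e).2 κ0) →
      ((r a1).1 ≠ 1 ∧ (r a1).1 κ1 = κ1 ∧ (r a1).2 κ1 = (r e).2 κ1) →
      ((r a2).1 ≠ 1 ∧ (r a2).1 κ2 = κ2 ∧ (r a2).2 κ2 = (r e).2 κ2) → (e.val + a0.val + a1.val + a2.val) % 2 = 1)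
    (h : ∀ R : Fin 18 → Equiv.Perm (Fin 3) × (Fin 3 → Fin 4),
      (∀ k, TropicalCensus.classSym (R k) = TropicalCensus.classSym (r k)) →
      (∀ k, (R k).1 = 1 ∨ (∃ i j : Fin 3, i < j ∧ (R k).1 = Equiv.swap i j ∧ (R k).2 i = (R k).2 j) ∨ (∀ i, (R k).1 i ≠ i)) →
      (∀ k, (R k).1 ≠ (finRotate 3)⁻¹) →
      (∀ a b : Fin 18, a < b → ∀ l₁ l₂ : Fin 3,
        ((R a).1 l₁ = (R b).1 l₂ ∧ l₁ = l₂) ∨ ((R a).1 l₁ = l₂ ∧ (R b).1 l₂ = l₁) → (R a).2 l₁ ≤ (R b).2 l₂) →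
      (∀ a b : Fin 18, a < b → TropicalCensus.slope g (R a) < TropicalCensus.slope g (R b)) →
      (∀ a b : Fin 18, a < b → (R a).1 = 1 → ∀ i j : Fin 3, i ≠ j → (R b).1 = Equiv.swap i j → (R b).2 i = (R b).2 j →
        g ((R a).2 i) + g ((R a).2 j) < 2 * g ((R b).2 i)) →
      (∀ a b : Fin 18, a < b → (R b).1 = 1 → ∀ i j : Fin 3, i ≠ j → (R a).1 = Equiv.swap i j → (R a).2 i = (R a).2 j →
        2 * g ((R a).2 i) < g ((R b).2 i) + g ((R b).2 j)) →
      (∀ a b : Fin 18, a < b → ∀ i j k : Fin 3, i ≠ j → k ≠ i → k ≠ j → (R a).1 = Equiv.swap i j →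
        (R a).2 i = (R a).2 j → (R b).1 i = j → (R b).1 j = k → (R b).1 k = i →
        g ((R a).2 k) + g ((R a).2 i) < g ((R b).2 j) + g ((R b).2 k)) →
      (∀ a b : Fin 18, a < b → ∀ i j k : Fin 3, i ≠ j → k ≠ i → k ≠ j → (R a).1 i = j → (R a).1 j = k → (R a).1 k = i →
        (R b).1 = Equiv.swap i j → (R b).2 i = (R b).2 j → g ((R a).2 j) + g ((R a).2 k) < g ((R b).2 k) + g ((R b).2 i)) →
      (∀ a b : Fin 18, a < b → (R a).1 = 1 → ∀ i j k : Fin 3, i ≠ j → k ≠ i → k ≠ j →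
        (R b).1 i = j → (R b).1 j = k → (R b).1 k = i → g ((R a).2 i) + g ((R a).2 j) < 2 * g ((R b).2 i)) →
      (∀ a b : Fin 18, a < b → (R b).1 = 1 → ∀ i j k : Fin 3, i ≠ j → k ≠ i → k ≠ j →
        (R a).1 i = j → (R a).1 j = k → (R a).1 k = i → 2 * g ((R a).2 i) < g ((R b).2 i) + g ((R b).2 j)) →
      (∀ a b c : Fin 18, ∀ i j k : Fin 3, i ≠ j → k ≠ i → k ≠ j →
        (R a).1 = Equiv.swap j k → (R a).2 j = (R a).2 k → (R b).1 = Equiv.swap i k → (R b).2 i = (R b).2 k →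
        (R c).1 = Equiv.swap i j → (R c).2 i = (R c).2 j →
        ¬ (g ((R c).2 i) + g ((R a).2 j) + g ((R b).2 k) ≤ g ((R a).2 i) + 2 * g ((R a).2 j) ∧
            g ((R c).2 i) + g ((R a).2 j) + g ((R b).2 k) ≤ g ((R b).2 j) + 2 * g ((R b).2 k) ∧
            g ((R c).2 i) + g ((R a).2 j) + g ((R b).2 k) ≤ g ((R c).2 k) + 2 * g ((R c).2 i) ∧
            g ((R a).2 i) + 2 * g ((R a).2 j) ≤ g ((R a).2 i) + g ((R b).2 j) + g ((R c).2 k) ∧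
            g ((R b).2 j) + 2 * g ((R b).2 k) ≤ g ((R a).2 i) + g ((R b).2 j) + g ((R c).2 k) ∧
            g ((R c).2 k) + 2 * g ((R c).2 i) ≤ g ((R a).2 i) + g ((R b).2 j) + g ((R c).2 k)) ∧
        ¬ (g ((R a).2 i) + g ((R b).2 j) + g ((R c).2 k) ≤ g ((R a).2 i) + 2 * g ((R a).2 j) ∧
            g ((R a).2 i) + g ((R b).2 j) + g ((R c).2 k) ≤ g ((R b).2 j) + 2 * g ((R b).2 k) ∧
            g ((R a).2 i) + g ((R b).2 j) + g ((R c).2 k) ≤ g ((R c).2 k) + 2 * g ((R c).2 i) ∧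
            g ((R a).2 i) + 2 * g ((R a).2 j) ≤ g ((R c).2 i) + g ((R a).2 j) + g ((R b).2 k) ∧
            g ((R b).2 j) + 2 * g ((R b).2 k) ≤ g ((R c).2 i) + g ((R a).2 j) + g ((R b).2 k) ∧
            g ((R c).2 k) + 2 * g ((R c).2 i) ≤ g ((R c).2 i) + g ((R a).2 j) + g ((R b).2 k))) →
      (∀ a b : Fin 18, ∀ k : Fin 3, (R a).1 ≠ 1 → (R a).1 k = k → (R b).1 ≠ 1 → (R b).1 k = k →
        (R a).2 k = (R b).2 k → (a.val + b.val) % 2 = 0) →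
      (∀ e a0 a1 a2 : Fin 18, ∀ κ0 κ1 κ2 : Fin 3, κ0 ≠ κ1 → κ0 ≠ κ2 → κ1 ≠ κ2 → (R e).1 = 1 →
        ((R a0).1 ≠ 1 ∧ (R a0).1 κ0 = κ0 ∧ (R a0).2 κ0 = (R e).2 κ0) →
        ((R a1).1 ≠ 1 ∧ (R a1).1 κ1 = κ1 ∧ (R a1).2 κ1 = (R e).2 κ1) →
        ((R a2).1 ≠ 1 ∧ (R a2).1 κ2 = κ2 ∧ (R a2).2 κ2 = (R e).2 κ2) → (e.val + a0.val + a1.val + a2.val) % 2 = 1) →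
      False) : False := by
  obtain ⟨ρfpf, ρne, ρii, ρne1, ρnesw⟩ := rho_facts
  -- the normalised chain
  let R : Fin 18 → Equiv.Perm (Fin 3) × (Fin 3 → Fin 4) := fun k =>
    if (r k).1 = (finRotate 3)⁻¹ then ((finRotate 3 : Equiv.Perm (Fin 3)), fun i => (r k).2 ((finRotate 3) i)) else r k
  -- changed / unchanged positions
  have Rch : ∀ k, (r k).1 = (finRotate 3)⁻¹ → R k = ((finRotate 3 : Equiv.Perm (Fin 3)), fun i => (r k).2 ((finRotate 3) i)) :=
    fun k hk => by simp [R, hk]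
  have Run : ∀ k, (r k).1 ≠ (finRotate 3)⁻¹ → R k = r k := fun k hk => by simp [R, hk]
  -- an element of `R` whose carrier is not `finRotate 3` is unchanged
  have unch : ∀ k, (R k).1 ≠ finRotate 3 → R k = r k := by
    intro k hk
    by_cases hc : (r k).1 = (finRotate 3)⁻¹
    · rw [Rch k hc] at hk; exact absurd rfl hk
    · exact Run k hc
  have unch1 : ∀ k, (R k).1 = 1 → R k = r k := fun k hk => unch k (by rw [hk]; exact Ne.symm ρne1)
  have unchT : ∀ k (i j : Fin 3), (R k).1 = Equiv.swap i j → R k = r k := fun k i j hk => unch k (by rw [hk]; exact Ne.symm (ρnesw i j))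
  have unchfix : ∀ k (i : Fin 3), (R k).1 i = i → R k = r k := fun k i hk => unch k (fun e => ρfpf i (by rw [← e]; exact hk))
  -- class multisets
  have hcs : ∀ k, TropicalCensus.classSym (R k) = TropicalCensus.classSym (r k) := by
    intro k
    by_cases hc : (r k).1 = (finRotate 3)⁻¹
    · rw [Rch k hc]
      have e : r k = ((r k).1, (r k).2) := rfl
      conv_rhs => rw [e]
      exact classSym_comp_perm (r k).1 (finRotate 3) (finRotate 3) (r k).2
    · rw [Run k hc]
  refine h R hcs ?_ ?_ ?_ ?_ ?_ ?_ ?_ ?_ ?_ ?_ ?_ ?_ ?_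
  · -- shapes
    intro k
    by_cases hc : (r k).1 = (finRotate 3)⁻¹
    · rw [Rch k hc]; exact Or.inr (Or.inr ρfpf)
    · rw [Run k hc]; exact hshape k
  · -- normalisation
    intro k
    by_cases hc : (r k).1 = (finRotate 3)⁻¹
    · rw [Rch k hc]; exact ρne
    · rw [Run k hc]; exact hc
  · -- rule M: a changed element reads, at column `l`, the cell of column `finRotate 3 l` of the original (transposed), same letter
    intro a b hab l₁ l₂ hcell
    -- reduce to the original chain with possibly relabelled columns
    have key : ∀ k (l : Fin 3), ∃ l' : Fin 3, (R k).2 l = (r k).2 l' ∧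
        (((R k).1 l = (r k).1 l' ∧ l = l') ∨ ((R k).1 l = l' ∧ (r k).1 l' = l)) := by
      intro k l
      by_cases hc : (r k).1 = (finRotate 3)⁻¹
      · refine ⟨(finRotate 3) l, by rw [Rch k hc], Or.inr ⟨by rw [Rch k hc], ?_⟩⟩
        rw [hc]; simp
      · exact ⟨l, by rw [Run k hc], Or.inl ⟨by rw [Run k hc], rfl⟩⟩
    obtain ⟨l₁', e₁, c₁⟩ := key a l₁
    obtain ⟨l₂', e₂, c₂⟩ := key b l₂
    rw [e₁, e₂]
    apply hM a b hab l₁' l₂'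
    -- combine the three cell relations: {(R a).1 l₁, l₁} = {(R b).1 l₂, l₂}, and each equals the original cell
    rcases hcell with ⟨h1, h2⟩ | ⟨h1, h2⟩ <;> rcases c₁ with ⟨p1, p2⟩ | ⟨p1, p2⟩ <;> rcases c₂ with ⟨q1, q2⟩ | ⟨q1, q2⟩
    · left; exact ⟨by rw [← p1, h1, q1], by rw [← p2, h2, q2]⟩
    · right; refine ⟨?_, ?_⟩
      · rw [← p1, h1, q1]
      · rw [← p2, h2]; exact q2
    · right; refine ⟨?_, ?_⟩
      · rw [p2]  -- goal (r a).1 l₁' = l₂' ; have p1 : (R a).1 l₁ = l₁', p2 : (r a).1 l₁' = l₁, h1: (R a).1 l₁ = (R b).1 l₂, h2 : l₁ = l₂, q1: (R b).1 l₂ = (r b).1 l₂', q2 : l₂ = l₂'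
        rw [h2, q2]
      · rw [← q1, ← h1, p1]
    · left; refine ⟨?_, ?_⟩
      · -- (r a).1 l₁' = (r b).1 l₂'  from p2 : (r a).1 l₁' = l₁, h2 : l₁ = l₂, q2 : (r b).1 l₂' = l₂
        rw [p2, h2, q2]
      · -- l₁' = l₂' from p1 : (R a).1 l₁ = l₁', h1 : (R a).1 l₁ = (R b).1 l₂, q1 : (R b).1 l₂ = l₂'
        rw [← p1, h1, q1]
    · -- h1 : (R a).1 l₁ = l₂, h2 : (R b).1 l₂ = l₁ ; p : same ; q : same
      right; exact ⟨by rw [← p1, h1, q2], by rw [← q1, h2, p2]⟩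
    · -- p same, q transposed: q1 : (R b).1 l₂ = l₂', q2 : (r b).1 l₂' = l₂
      left; refine ⟨?_, ?_⟩
      · rw [← p1, h1, q2]  -- (r a).1 l₁' = (r b).1 l₂' : (r a).1 l₁' = (R a).1 l₁ = l₂ ; (r b).1 l₂' = l₂
      · rw [← p2, ← h2, q1]
    · -- p transposed (p1 : (R a).1 l₁ = l₁', p2 : (r a).1 l₁' = l₁), q same (q1 : (R b).1 l₂ = (r b).1 l₂', q2 : l₂ = l₂')
      left; refine ⟨?_, ?_⟩
      · rw [p2, ← h2, q1]
      · rw [← p1, h1, q2]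
    · -- both transposed: p1 : (R a).1 l₁ = l₁', p2 : (r a).1 l₁' = l₁, q1 : (R b).1 l₂ = l₂', q2 : (r b).1 l₂' = l₂
      right; exact ⟨by rw [p2, ← h2, q1], by rw [q2, ← h1, p1]⟩
  · -- rule S
    intro a b hab
    have e : ∀ k, TropicalCensus.slope g (R k) = TropicalCensus.slope g (r k) := fun k => by
      rw [slope_eq_of_classSym, slope_eq_of_classSym, hcs]
    rw [e, e]; exact hS a b hab
  · -- R1
    intro a b hab ha1 i j hij hb1 hcc
    have ea := unch1 a ha1; have eb := unchT b i j hb1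
    rw [ea] at ha1 ⊢; rw [eb] at hb1 hcc ⊢
    exact hR1 a b hab ha1 i j hij hb1 hcc
  · -- R1'
    intro a b hab hb1 i j hij ha1 hcc
    have eb := unch1 b hb1; have ea := unchT a i j ha1
    rw [eb] at hb1 ⊢; rw [ea] at ha1 hcc ⊢
    exact hR1' a b hab hb1 i j hij ha1 hcc
  · -- R2 : the pair carrier `b` may be transposed
    intro a b hab i j k hij hki hkj ha1 hcc hbi hbj hbk
    have ea := unchT a i j ha1
    rw [ea] at ha1 hcc ⊢
    by_cases hc : (r b).1 = (finRotate 3)⁻¹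
    · have eb := Rch b hc
      rw [eb] at hbi hbj hbk ⊢
      dsimp only at hbi hbj hbk ⊢
      -- original carrier: (r b).1 = ρ⁻¹ sends j ↦ i, i ↦ k, k ↦ j
      have o1 : (r b).1 j = i := by rw [hc]; exact (Equiv.Perm.inv_eq_iff_eq).mpr hbi.symm
      have o2 : (r b).1 i = k := by rw [hc]; exact (Equiv.Perm.inv_eq_iff_eq).mpr hbk.symm
      have o3 : (r b).1 k = j := by rw [hc]; exact (Equiv.Perm.inv_eq_iff_eq).mpr hbj.symm
      have h' := hR2 a b hab j i k hij.symm hkj hki (by rw [ha1, Equiv.swap_comm]) hcc.symm o1 o2 o3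
      rw [hbj, hbk, hcc]
      linarith
    · rw [Run b hc] at hbi hbj hbk ⊢
      exact hR2 a b hab i j k hij hki hkj ha1 hcc hbi hbj hbk
  · -- R2'
    intro a b hab i j k hij hki hkj hai haj hak hb1 hcc
    have eb' := unchT b i j hb1
    rw [eb'] at hb1 hcc ⊢
    by_cases hc : (r a).1 = (finRotate 3)⁻¹
    · have ea := Rch a hc
      rw [ea] at hai haj hak ⊢
      dsimp only at hai haj hak ⊢
      have o1 : (r a).1 j = i := by rw [hc]; exact (Equiv.Perm.inv_eq_iff_eq).mpr hai.symm
      have o2 : (r a).1 i = k := by rw [hc]; exact (Equiv.Perm.inv_eq_iff_eq).mpr hak.symm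
      have o3 : (r a).1 k = j := by rw [hc]; exact (Equiv.Perm.inv_eq_iff_eq).mpr haj.symm
      have h' := hR2' a b hab j i k hij.symm hkj hki o1 o2 o3 (by rw [hb1, Equiv.swap_comm]) hcc.symm
      rw [haj, hak, hcc]
      linarith
    · rw [Run a hc] at hai haj hak ⊢
      exact hR2' a b hab i j k hij hki hkj hai haj hak hb1 hcc
  · -- R3
    intro a b hab ha1 i j k hij hki hkj hbi hbj hbk
    have ea := unch1 a ha1
    rw [ea] at ha1 ⊢
    by_cases hc : (r b).1 = (finRotate 3)⁻¹
    · have eb := Rch b hc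
      rw [eb] at hbi hbj hbk ⊢
      dsimp only at hbi hbj hbk ⊢
      have o1 : (r b).1 j = i := by rw [hc]; exact (Equiv.Perm.inv_eq_iff_eq).mpr hbi.symm
      have o2 : (r b).1 i = k := by rw [hc]; exact (Equiv.Perm.inv_eq_iff_eq).mpr hbk.symm
      have o3 : (r b).1 k = j := by rw [hc]; exact (Equiv.Perm.inv_eq_iff_eq).mpr hbj.symm
      have h' := hR3 a b hab ha1 j i k hij.symm hkj hki o1 o2 o3
      rw [hbi]
      linarith
    · rw [Run b hc] at hbi hbj hbk ⊢
      exact hR3 a b hab ha1 i j k hij hki hkj hbi hbj hbk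
  · -- R3'
    intro a b hab hb1 i j k hij hki hkj hai haj hak
    have eb' := unch1 b hb1
    rw [eb'] at hb1 ⊢
    by_cases hc : (r a).1 = (finRotate 3)⁻¹
    · have ea := Rch a hc
      rw [ea] at hai haj hak ⊢
      dsimp only at hai haj hak ⊢
      have o1 : (r a).1 j = i := by rw [hc]; exact (Equiv.Perm.inv_eq_iff_eq).mpr hai.symm
      have o2 : (r a).1 i = k := by rw [hc]; exact (Equiv.Perm.inv_eq_iff_eq).mpr hak.symm
      have o3 : (r a).1 k = j := by rw [hc]; exact (Equiv.Perm.inv_eq_iff_eq).mpr haj.symm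
      have h' := hR3' a b hab hb1 j i k hij.symm hkj hki o1 o2 o3
      rw [hai]
      linarith
    · rw [Run a hc] at hai haj hak ⊢
      exact hR3' a b hab hb1 i j k hij hki hkj hai haj hak
  · -- T3 (all three are transpositions: unchanged)
    intro a b c i j k hij hki hkj ha1 hca hb1 hcb hc1 hcc
    have ea := unchT a j k ha1; have eb := unchT b i k hb1; have ec := unchT c i j hc1
    rw [ea] at ha1 hca ⊢; rw [eb] at hb1 hcb ⊢; rw [ec] at hc1 hcc ⊢
    exact hT3 a b c i j k hij hki hkj ha1 hca hb1 hcb hc1 hcc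
  · -- P1
    intro a b k ha1 hak hb1 hbk hx
    have ea := unchfix a k hak; have eb := unchfix b k hbk
    rw [ea] at ha1 hak hx; rw [eb] at hb1 hbk hx
    exact hP1 a b k ha1 hak hb1 hbk hx
  · -- P2
    intro e a0 a1 a2 κ0 κ1 κ2 h01 h02 h12 he1 h0 h1 h2
    have ee := unch1 e he1; have e0 := unchfix a0 κ0 h0.2.1; have e1 := unchfix a1 κ1 h1.2.1; have e2 := unchfix a2 κ2 h2.2.1
    rw [ee] at he1 h0 h1 h2; rw [e0] at h0; rw [e1] at h1; rw [e2] at h2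
    exact hP2 e a0 a1 a2 κ0 κ1 κ2 h01 h02 h12 he1 h0 h1 h2

end SymmetricOrbitThreeFourSixteen

end Summit.ValiantsHypothesis.ValiantsHypothesis.Theorems.KPlusLogSqLaw
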